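import Summits.HodgeConjecture.CorCM.Census.OcticTwistOrientedSlices
import Summits.HodgeConjecture.CorCM.Census.OcticTwistLaw
import Summits.HodgeConjecture.CorCM.Census.QuarticTwistAll

/-!
# The octic twist `(ℤ/8 × B, (4,0))`, XX: THE CLOSING WITHOUT A REGIME and `β − 1` RANK-FOUR FACES FOR EVERY FINITE GROUP `B` OF
# ORDER `≥ 3` (any parity)

COR-CM (cell `pub-hodgecm2`), count-neutral kernel combinatorics by the binder seat b09 (gen 34; lane COINVARIANT-TWIST / OCTIC RECON, the
even-order road map of `HOME/pub-hodgecm2-b09/lean-g34/OCTIC-LAW.md`), on top of part XVII (`UCovers`, `exists_ucover_family`), part XIII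
(`Census/OcticTwistClosing.lean`: `affine_tens_sub_cst_tens_mem`, `prof_sub_reg`, the nine faces), parts III, V, IX, XII, XVI (`exists_reduced₂`,
`covers₂_mono`, `ten_le_card_residual_blocks`, `residual₂_mem`, `closing_moves`, `spanMot_mono`, `transl₂_mem_sup`, `card_blocks_split`) and the
quartic files (`QuarticTwistReduction`: `affine`, `affine_square`, `affine_atom`; `QuarticTwistOrientation`: `IsUpper`, `isUpper_unique`,
`isUpper_atom`, **`isUpper_corners`**; `QuarticTwistClosing`: `prof`, `corners`, `closing_column`, `closing_square`; `QuarticTwistAll`: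
`exists_equator'`) BY NAME.  Theorems only; no definition, no certificate, no named fact, no `sorry`.
HONEST FRAMING: `HC_CM` is NOT proved, here or anywhere in the tree; nothing here is a period or a headline.

* §1 **`exists_single_sub_affine_mem_upper`** (`|B| ≥ 3`, any parity): if `M ≤ ℤ^{Ty B}` satisfies `UCovers`, then for every type `s`
  there is `u` — the upper end of `s`, or any common upper end of the corners of its square when `s` is balanced — with
  `e_s − A_u(s) ∈ M` (strong induction on `Φ`: the corners are not balanced, so by `isUpper_unique` the induction hypothesis is read at the
  SAME `u`, and `affine_square` telescopes); NO orientation function is needed.  For a type with an upper end `u` this is `e_s − A_u(s) ∈ M`,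
  and on a slice `{v | v ⊗ e_y ∈ N}`: `e_s ⊗ e_y − A_u(s) ⊗ e_y ∈ N`.
* §2 THE NINE CLASSES (`closing_classes_upper`; `|B| ∈ {2a+1, 2a+2}`, `a ≥ 1`, `|Q| = a`, `i ≠ j` outside `Q`): exactly as in part XIII with
  the regimes of the six corner types replaced by their UPPER ENDS (`isUpper_corners`).
* §3 **`hodge₂_le_upper`** (family form, `|B| ∈ {2a+1, 2a+2}`, `a ≥ 1`): a motion-stable `N ≤ hodge₂` containing the octic pairs, covering
(`Covers₂`), whose slices at the small residual passive coordinates satisfy `UCovers` (part XVIII), and which contains the mixed squares and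
the nine closing faces, is all of `hodge₂` — part XVIʼs `hodge₂_le` with the regime replaced by upper ends.
* §4 **`exists_faces_generate₂_all`** (`|B| ≥ 3`, ANY parity): there is a finite family `S` of octic rank-four faces (coset faces and mixed faces)
with `hodge₂ B ≤ pairs₂ B ⊔ spanMot B S` and `|S| + 1 ≤ β(ℤ/8 × B)`: **`μ(ℤ/8 × B, (4,0)) ≤ β − 1` for every finite group `B` of order `≥ 3`**.
For `|B|` odd this is an equality (part XVI `octicTwist_law_eq`); for `|B|` even the block parities of part XV give only `β − 2 ≤ μ` as they
stand (the Weil parities lose their atom component), and the expected law `μ = β − 1 − [∃ t ∈ B, 8 ∣ ord t]` (twist fibre law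
`Census/CoinvariantTwistLaw.lean` at `j = 2`) needs the half-parity functional and the screw types one level up — successor parts.  All [folklore].

## References
* [Pohlmann1968] H. Pohlmann, Algebraic cycles on abelian varieties of complex multiplication type, Ann. of Math. 88 (1968), Thm 1.
* [Milne1999] J. S. Milne, Lefschetz motives and the Tate conjecture, Compositio Math. 117 (1999), Prop. 2.1, p. 54.
-/

namespace Summit.HodgeConjecture.CorCM.Census.OcticTwist

open Finset
open Summit.HodgeConjecture.CorCM.Census.QuarticTwist

variable (B : Type) [AddGroup B] [Fintype B] [DecidableEq B]

/-! ## §1 The upper-end affine reduction -/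

omit [AddGroup B] in
/-- **THE UPPER-END AFFINE REDUCTION** (`|B| ≥ 3`, any parity).  If `M` satisfies `UCovers`, then for every type `s` there is `u`, the upper end
of `s` unless `s` is balanced, with `e_s − A_u(s) ∈ M`. [folklore] -/
theorem exists_single_sub_affine_mem_upper (h3 : 3 ≤ Fintype.card B) {M : Submodule ℤ (Ty B → ℤ)} (hM : UCovers B M) (s : Ty B) :
    ∃ u : ZMod 4, (IsUpper B u s ∨ ∀ w, IsMin B w s) ∧ Pi.single s 1 - affine B u s ∈ M := by
  induction hΦ : Phi B s using Nat.strong_induction_on generalizing s with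
  | _ n ih =>
  by_cases hres : IsRes B s
  · obtain ⟨u, b, k, rfl⟩ := hres
    refine ⟨u, Or.inl (isUpper_atom B h3 u b k), ?_⟩
    rw [affine_atom, sub_self]
    exact Submodule.zero_mem _
  · obtain ⟨u, p, q, hpq, hface, hor, ⟨h1, r1⟩, ⟨h2, r2⟩, ⟨h12, r12⟩⟩ := hM s hres
    -- the induction hypothesis at the three corners, read at the same `u`
    have corner : ∀ c : Ty B, Phi B c < Phi B s → IsUpper B u c → Pi.single c 1 - affine B u c ∈ M := by
      intro c hc huc
      obtain ⟨u', hu', hmem⟩ := ih _ (hc.trans_eq hΦ) c rfl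
      rcases hu' with hu' | hbal
      · rw [isUpper_unique B huc hu'] at hmem
        exact hmem
      · exact absurd (hbal (u + 1)) huc.2
    have i₁ := corner _ h1 r1
    have i₂ := corner _ h2 r2
    have i₁₂ := corner _ h12 r12
    obtain ⟨e₁, he₁⟩ : ∃ e₁, step p.1 (s p.2) = e₁ := ⟨_, rfl⟩
    obtain ⟨e₂, he₂⟩ : ∃ e₂, step q.1 (s q.2) = e₂ := ⟨_, rfl⟩
    have hs₁ : QuarticTwist.flip B p s = s + Pi.single p.2 e₁ := by rw [flip_eq_add_single, he₁]
    have hs₂ : QuarticTwist.flip B q s = s + Pi.single q.2 e₂ := by rw [flip_eq_add_single, he₂]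
    have hs₁₂ : QuarticTwist.flip B q (QuarticTwist.flip B p s) = s + Pi.single p.2 e₁ + Pi.single q.2 e₂ := by
      rw [flip_flip_of_ne B p q hpq s, he₁, he₂]
    have hadd := affine_square B u s hpq e₁ e₂
    rw [← hs₁₂, ← hs₁, ← hs₂] at hadd
    refine ⟨u, hor.symm, ?_⟩
    have key : Pi.single s 1 - affine B u s = faceVec B s p q + (Pi.single (QuarticTwist.flip B p s) 1 - affine B u (QuarticTwist.flip B p s))
        + (Pi.single (QuarticTwist.flip B q s) 1 - affine B u (QuarticTwist.flip B q s))
        - (Pi.single (QuarticTwist.flip B q (QuarticTwist.flip B p s)) 1 - affine B u (QuarticTwist.flip B q (QuarticTwist.flip B p s)))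
        - (affine B u s - affine B u (QuarticTwist.flip B p s) - affine B u (QuarticTwist.flip B q s)
            + affine B u (QuarticTwist.flip B q (QuarticTwist.flip B p s))) := by
      unfold faceVec; abel
    rw [key, hadd, sub_zero]
    exact Submodule.sub_mem _ (Submodule.add_mem _ (Submodule.add_mem _ hface i₁) i₂) i₁₂

omit [AddGroup B] in
/-- **For a type with an upper end `u`: `e_s − A_u(s) ∈ M`** (`UCovers M`, `|B| ≥ 3`). [folklore] -/
theorem single_sub_affine_mem_of_isUpper (h3 : 3 ≤ Fintype.card B) {M : Submodule ℤ (Ty B → ℤ)} (hM : UCovers B M) {s : Ty B}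
    {u : ZMod 4} (hu : IsUpper B u s) : Pi.single s 1 - affine B u s ∈ M := by
  obtain ⟨u', hu', hmem⟩ := exists_single_sub_affine_mem_upper B h3 hM s
  rcases hu' with hu' | hbal
  · rw [isUpper_unique B hu hu'] at hmem
    exact hmem
  · exact absurd (hbal (u + 1)) hu.2

omit [AddGroup B] in
/-- **Slice form**: if the slice `{v | v ⊗ e_y ∈ N}` satisfies `UCovers` and `s` has upper end `u`, then `e_s ⊗ e_y − A_u(s) ⊗ e_y ∈ N`. [folklore] -/
theorem single_tens_sub_affine_tens_mem_of_isUpper (h3 : 3 ≤ Fintype.card B) {N : Submodule ℤ (Ty₂ B → ℤ)} {y : Ty B}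
    (hcov : UCovers B (N.comap (emb₀ B y))) {s : Ty B} {u : ZMod 4} (hu : IsUpper B u s) :
    tens B (Pi.single s 1) (Pi.single y 1) - tens B (affine B u s) (Pi.single y 1) ∈ N := by
  have h := single_sub_affine_mem_of_isUpper B h3 hcov hu
  rw [Submodule.mem_comap, emb₀_apply, tens_sub_left] at h
  exact h

/-! ## §2 The nine closing classes, any parity -/

omit [AddGroup B] in
/-- **REDUCTION OF A MIXED CLOSING FACE, any parity** (`|B| ∈ {2a+1, 2a+2}`, `a ≥ 1`, `|Q| = a`, `i ≠ j` outside `Q`; `a′ = Δ + kδ_{b₁}`,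
`k = ±1`). [folklore] -/
theorem closing_mixed_mem_upper {a : ℕ} (ha : 1 ≤ a) (hn : Fintype.card B = 2 * a + 1 ∨ Fintype.card B = 2 * a + 2)
    {Q : Finset B} (hQ : Q.card = a) {i j : B} (hi : i ∉ Q) (hj : j ∉ Q) (hji : j ≠ i) {N : Submodule ℤ (Ty₂ B → ℤ)}
    (hsq : ∀ (u : ZMod 4) (b : B) (k : ZMod 4) (u' : ZMod 4) (b' : B) (k' : ZMod 4), (k = 1 ∨ k = -1) → (k' = 1 ∨ k' = -1) →
      tens B (Pi.single (atom B u b k) 1 - Pi.single (cst B u) 1) (Pi.single (atom B u' b' k') 1 - Pi.single (cst B u') 1) ∈ N)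
    (Δ : ZMod 4) (b₁ : B) {k : ZMod 4} (hk : k = 1 ∨ k = -1)
    (hcovA : UCovers B (N.comap (emb₀ B (atom B Δ b₁ k)))) (hcovC : UCovers B (N.comap (emb₀ B (cst B Δ))))
    (hF : tens B (Pi.single (prof B Q i 0) 1 - Pi.single (prof B Q i 1) 1) (Pi.single (atom B Δ b₁ k) 1 - Pi.single (cst B Δ) 1) ∈ N) :
    tens B (Pi.single (cst B 0) 1 - Pi.single (cst B 1) 1) (Pi.single (cst B Δ) 1 - Pi.single (atom B Δ b₁ k) 1) ∈ N := by
  have h3 : 3 ≤ Fintype.card B := by omega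
  obtain ⟨r0, r1, -, -, -, -⟩ := isUpper_corners B ha hn Q hQ hi hj hji
  have sA0 := single_tens_sub_affine_tens_mem_of_isUpper B h3 hcovA r0
  have sA1 := single_tens_sub_affine_tens_mem_of_isUpper B h3 hcovA r1
  have sC0 := single_tens_sub_affine_tens_mem_of_isUpper B h3 hcovC r0
  have sC1 := single_tens_sub_affine_tens_mem_of_isUpper B h3 hcovC r1
  obtain ⟨hs0, hs1⟩ := prof_sub_reg B Q i
  have a0 := affine_tens_sub_cst_tens_mem B hsq 0 hs0 Δ b₁ hk
  have a1 := affine_tens_sub_cst_tens_mem B hsq 1 hs1 Δ b₁ hk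
  have e : tens B (Pi.single (cst B 0) 1 - Pi.single (cst B 1) 1) (Pi.single (cst B Δ) 1 - Pi.single (atom B Δ b₁ k) 1)
      = -(tens B (Pi.single (prof B Q i 0) 1 - Pi.single (prof B Q i 1) 1) (Pi.single (atom B Δ b₁ k) 1 - Pi.single (cst B Δ) 1)
        - (tens B (Pi.single (prof B Q i 0) 1) (Pi.single (atom B Δ b₁ k) 1) - tens B (affine B 0 (prof B Q i 0)) (Pi.single (atom B Δ b₁ k) 1))
        + (tens B (Pi.single (prof B Q i 1) 1) (Pi.single (atom B Δ b₁ k) 1) - tens B (affine B 1 (prof B Q i 1)) (Pi.single (atom B Δ b₁ k) 1))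
        + (tens B (Pi.single (prof B Q i 0) 1) (Pi.single (cst B Δ) 1) - tens B (affine B 0 (prof B Q i 0)) (Pi.single (cst B Δ) 1))
        - (tens B (Pi.single (prof B Q i 1) 1) (Pi.single (cst B Δ) 1) - tens B (affine B 1 (prof B Q i 1)) (Pi.single (cst B Δ) 1))
        - (tens B (affine B 0 (prof B Q i 0)) (Pi.single (atom B Δ b₁ k) 1 - Pi.single (cst B Δ) 1)
            - tens B (Pi.single (cst B 0) 1) (Pi.single (atom B Δ b₁ k) 1 - Pi.single (cst B Δ) 1))
        + (tens B (affine B 1 (prof B Q i 1)) (Pi.single (atom B Δ b₁ k) 1 - Pi.single (cst B Δ) 1)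
            - tens B (Pi.single (cst B 1) 1) (Pi.single (atom B Δ b₁ k) 1 - Pi.single (cst B Δ) 1))) := by
    funext T
    simp only [tens, Pi.add_apply, Pi.sub_apply, Pi.neg_apply]
    ring
  rw [e]
  refine Submodule.neg_mem _ ?_
  exact Submodule.add_mem _ (Submodule.sub_mem _ (Submodule.sub_mem _ (Submodule.add_mem _ (Submodule.add_mem _
    (Submodule.sub_mem _ hF sA0) sA1) sC0) sC1) a0) a1

omit [AddGroup B] in
/-- **REDUCTION OF THE COLUMN CLOSING FACE, any parity** (`|B| ∈ {2a+1, 2a+2}`, `a ≥ 1`, `|Q| = a`, `i ≠ j` outside `Q`). [folklore] -/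
theorem closing_column_mem_upper {a : ℕ} (ha : 1 ≤ a) (hn : Fintype.card B = 2 * a + 1 ∨ Fintype.card B = 2 * a + 2)
    {Q : Finset B} (hQ : Q.card = a) {i j : B} (hi : i ∉ Q) (hj : j ∉ Q) (hji : j ≠ i) {N : Submodule ℤ (Ty₂ B → ℤ)}
    (hcov0 : UCovers B (N.comap (emb₀ B (cst B 0))))
    (hF : tens B (faceVec B (prof B Q i 0) ((0 : ZMod 2), i) ((1 : ZMod 2), i)) (Pi.single (cst B 0) 1) ∈ N) :
    tens B (Xvec B 1 i + pairVec B (cst B 0) - pairVec B (atom B 0 i (-1))) (Pi.single (cst B 0) 1) ∈ N := by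
  have h3 : 3 ≤ Fintype.card B := by omega
  obtain ⟨c1, c2, c12, -, -⟩ := corners B Q hi hj hji
  obtain ⟨r0, r1, rm1, r2, -, -⟩ := isUpper_corners B ha hn Q hQ hi hj hji
  have s0 := single_tens_sub_affine_tens_mem_of_isUpper B h3 hcov0 r0
  have s1 := single_tens_sub_affine_tens_mem_of_isUpper B h3 hcov0 r1
  have sm1 := single_tens_sub_affine_tens_mem_of_isUpper B h3 hcov0 rm1
  have s2 := single_tens_sub_affine_tens_mem_of_isUpper B h3 hcov0 r2
  have e : tens B (Xvec B 1 i + pairVec B (cst B 0) - pairVec B (atom B 0 i (-1))) (Pi.single (cst B 0) 1)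
      = tens B (faceVec B (prof B Q i 0) ((0 : ZMod 2), i) ((1 : ZMod 2), i)) (Pi.single (cst B 0) 1)
        - (tens B (Pi.single (prof B Q i 0) 1) (Pi.single (cst B 0) 1) - tens B (affine B 0 (prof B Q i 0)) (Pi.single (cst B 0) 1))
        + (tens B (Pi.single (prof B Q i 1) 1) (Pi.single (cst B 0) 1) - tens B (affine B 1 (prof B Q i 1)) (Pi.single (cst B 0) 1))
        + (tens B (Pi.single (prof B Q i (-1)) 1) (Pi.single (cst B 0) 1) - tens B (affine B 0 (prof B Q i (-1))) (Pi.single (cst B 0) 1))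
        - (tens B (Pi.single (prof B Q i 2) 1) (Pi.single (cst B 0) 1) - tens B (affine B 1 (prof B Q i 2)) (Pi.single (cst B 0) 1)) := by
    rw [← closing_column B Q hi]
    unfold faceVec
    rw [c12, c1, c2]
    funext T
    simp only [tens, Pi.add_apply, Pi.sub_apply]
    ring
  rw [e]
  exact Submodule.sub_mem _ (Submodule.add_mem _ (Submodule.add_mem _ (Submodule.sub_mem _ hF s0) s1) sm1) s2

omit [AddGroup B] in
/-- **REDUCTION OF AN EQUATORIAL CLOSING FACE, any parity** (`|B| ∈ {2a+1, 2a+2}`, `a ≥ 1`, `|Q| = a`, `i ≠ j` outside `Q`). [folklore] -/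
theorem closing_square_mem_upper {a : ℕ} (ha : 1 ≤ a) (hn : Fintype.card B = 2 * a + 1 ∨ Fintype.card B = 2 * a + 2)
    {Q : Finset B} (hQ : Q.card = a) {i j : B} (hi : i ∉ Q) (hj : j ∉ Q) (hji : j ≠ i) {N : Submodule ℤ (Ty₂ B → ℤ)}
    (c : Ty B) (hcov : UCovers B (N.comap (emb₀ B c)))
    (hF : tens B (faceVec B (prof B Q i 0) ((0 : ZMod 2), i) ((0 : ZMod 2), j)) (Pi.single c 1) ∈ N) :
    tens B ((∑ q ∈ Q, Xvec B 0 q) - Wvec B 1) (Pi.single c 1) ∈ N := by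
  have h3 : 3 ≤ Fintype.card B := by omega
  obtain ⟨c1, -, -, cj, cij⟩ := corners B Q hi hj hji
  obtain ⟨r0, r1, -, -, rj0, rj1⟩ := isUpper_corners B ha hn Q hQ hi hj hji
  have s0 := single_tens_sub_affine_tens_mem_of_isUpper B h3 hcov r0
  have s1 := single_tens_sub_affine_tens_mem_of_isUpper B h3 hcov r1
  have sj0 := single_tens_sub_affine_tens_mem_of_isUpper B h3 hcov rj0
  have sj1 := single_tens_sub_affine_tens_mem_of_isUpper B h3 hcov rj1
  have e : tens B ((∑ q ∈ Q, Xvec B 0 q) - Wvec B 1) (Pi.single c 1)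
      = tens B (faceVec B (prof B Q i 0) ((0 : ZMod 2), i) ((0 : ZMod 2), j)) (Pi.single c 1)
        - (tens B (Pi.single (prof B Q i 0) 1) (Pi.single c 1) - tens B (affine B 0 (prof B Q i 0)) (Pi.single c 1))
        + (tens B (Pi.single (prof B Q i 1) 1) (Pi.single c 1) - tens B (affine B 1 (prof B Q i 1)) (Pi.single c 1))
        + (tens B (Pi.single (prof B (insert j Q) i 0) 1) (Pi.single c 1) - tens B (affine B 1 (prof B (insert j Q) i 0)) (Pi.single c 1))
        - (tens B (Pi.single (prof B (insert j Q) i 1) 1) (Pi.single c 1) - tens B (affine B 1 (prof B (insert j Q) i 1)) (Pi.single c 1)) := by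
    rw [← closing_square B Q hi hj hji]
    unfold faceVec
    rw [cij, c1, cj]
    funext T
    simp only [tens, Pi.add_apply, Pi.sub_apply]
    ring
  rw [e]
  exact Submodule.sub_mem _ (Submodule.add_mem _ (Submodule.add_mem _ (Submodule.sub_mem _ hF s0) s1) sj0) sj1

omit [AddGroup B] in
/-- **THE NINE CLASSES OF THE CLOSING, any parity** (`|B| ∈ {2a+1, 2a+2}`, `a ≥ 1`, `|Q| = a`, `i ≠ j` outside `Q`, `b₁` any column): if `N`
contains the mixed squares, its slices `{v | v ⊗ e_y ∈ N}` at every small residual `y` satisfy `UCovers`, and `N` contains the nine closing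
faces of part XIII, then `N` contains the nine classes `hF1`, `hF2`, `hF3` of part XII `closing_moves`. [folklore] -/
theorem closing_classes_upper {a : ℕ} (ha : 1 ≤ a) (hn : Fintype.card B = 2 * a + 1 ∨ Fintype.card B = 2 * a + 2)
    {Q : Finset B} (hQ : Q.card = a) {i j : B} (hi : i ∉ Q) (hj : j ∉ Q) (hji : j ≠ i) (b₁ : B) {N : Submodule ℤ (Ty₂ B → ℤ)}
    (hsq : ∀ (u : ZMod 4) (b : B) (k : ZMod 4) (u' : ZMod 4) (b' : B) (k' : ZMod 4), (k = 1 ∨ k = -1) → (k' = 1 ∨ k' = -1) →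
      tens B (Pi.single (atom B u b k) 1 - Pi.single (cst B u) 1) (Pi.single (atom B u' b' k') 1 - Pi.single (cst B u') 1) ∈ N)
    (hcov : ∀ y : Ty B, IsRes B y → (¬ ∃ (u : ZMod 4) (b : B), y = atom B u b 2) → UCovers B (N.comap (emb₀ B y)))
    (hM : ∀ Δ k : ZMod 4, (Δ = 0 ∨ Δ = 1 ∨ Δ = 2) → (k = 1 ∨ k = -1) →
      tens B (Pi.single (prof B Q i 0) 1 - Pi.single (prof B Q i 1) 1) (Pi.single (atom B Δ b₁ k) 1 - Pi.single (cst B Δ) 1) ∈ N)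
    (hC : tens B (faceVec B (prof B Q i 0) ((0 : ZMod 2), i) ((1 : ZMod 2), i)) (Pi.single (cst B 0) 1) ∈ N)
    (hE : ∀ c : ZMod 4, (c = 0 ∨ c = 1) → tens B (faceVec B (prof B Q i 0) ((0 : ZMod 2), i) ((0 : ZMod 2), j)) (Pi.single (cst B c) 1) ∈ N) :
    (∀ Δ k : ZMod 4, (Δ = 0 ∨ Δ = 1 ∨ Δ = 2) → (k = 1 ∨ k = -1) →
      tens B (Pi.single (cst B 0) 1 - Pi.single (cst B 1) 1) (Pi.single (cst B Δ) 1 - Pi.single (atom B Δ b₁ k) 1) ∈ N) ∧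
    tens B (Xvec B 1 i + pairVec B (cst B 0) - pairVec B (atom B 0 i (-1))) (Pi.single (cst B 0) 1) ∈ N ∧
    (∀ c : ZMod 4, (c = 0 ∨ c = 1) → tens B ((∑ q ∈ Q, Xvec B 0 q) - Wvec B 1) (Pi.single (cst B c) 1) ∈ N) := by
  have h3 : 3 ≤ Fintype.card B := by omega
  have pm1 : ∀ {k : ZMod 4}, (k = 1 ∨ k = -1) → k ≠ 0 := fun hk => by
    rcases hk with rfl | rfl <;> decide
  have hcst : ∀ u : ZMod 4, UCovers B (N.comap (emb₀ B (cst B u))) := fun u =>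
    hcov _ ⟨u, b₁, 0, (atom_zero B u b₁).symm⟩ (fun ⟨u', b, h⟩ => atom_ne_cst B h3 (by decide) u h.symm)
  have hatm : ∀ (Δ : ZMod 4) (k : ZMod 4), (k = 1 ∨ k = -1) → UCovers B (N.comap (emb₀ B (atom B Δ b₁ k))) := fun Δ k hk =>
    hcov _ ⟨Δ, b₁, k, rfl⟩ (fun ⟨u', b, h⟩ => by
      have h2 := ((atom_eq_atom_iff B h3 (pm1 hk)).mp h).2.2
      rcases hk with rfl | rfl
      · exact absurd h2 (by decide)
      · exact absurd h2 (by decide))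
  refine ⟨fun Δ k hΔ hk => ?_, ?_, fun c hc => ?_⟩
  · exact closing_mixed_mem_upper B ha hn hQ hi hj hji hsq Δ b₁ hk (hatm Δ k hk) (hcst Δ) (hM Δ k hΔ hk)
  · exact closing_column_mem_upper B ha hn hQ hi hj hji (hcst 0) hC
  · exact closing_square_mem_upper B ha hn hQ hi hj hji (cst B c) (hcst c) (hE c hc)

/-! ## §3 The generation theorem, family form, any parity -/

/-- **THE OCTIC GENERATION THEOREM, family form, any parity** (`|B| ∈ {2a+1, 2a+2}`, `a ≥ 1`, `|Q| = a`, `i ≠ j` outside `Q`).  A motion-stable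
`N ≤ hodge₂` containing the octic pairs, covering (`Covers₂`), whose slices at the small residual passive coordinates satisfy `UCovers`, and
which contains the mixed squares and the nine closing faces of part XIII, is all of `hodge₂`. [folklore] -/
theorem hodge₂_le_upper {a : ℕ} (ha : 1 ≤ a) (hn : Fintype.card B = 2 * a + 1 ∨ Fintype.card B = 2 * a + 2)
    {Q : Finset B} (hQ : Q.card = a) {i j : B} (hi : i ∉ Q) (hj : j ∉ Q) (hji : j ≠ i) {N : Submodule ℤ (Ty₂ B → ℤ)}
    (hNH : N ≤ hodge₂ B) (hmot : ∀ v ∈ N, ∀ (e : Bool) (h : ZMod 4 × B), transl₂ B e h v ∈ N) (hP : pairs₂ B ≤ N)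
    (hcov₂ : Covers₂ B N)
    (hcov : ∀ y : Ty B, IsRes B y → (¬ ∃ (u : ZMod 4) (b : B), y = atom B u b 2) → UCovers B (N.comap (emb₀ B y)))
    (hsq : ∀ (u : ZMod 4) (b : B) (k : ZMod 4) (u' : ZMod 4) (b' : B) (k' : ZMod 4), (k = 1 ∨ k = -1) → (k' = 1 ∨ k' = -1) →
      tens B (Pi.single (atom B u b k) 1 - Pi.single (cst B u) 1) (Pi.single (atom B u' b' k') 1 - Pi.single (cst B u') 1) ∈ N)
    (hM : ∀ Δ k : ZMod 4, (Δ = 0 ∨ Δ = 1 ∨ Δ = 2) → (k = 1 ∨ k = -1) →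
      tens B (Pi.single (prof B Q i 0) 1 - Pi.single (prof B Q i 1) 1) (Pi.single (atom B Δ i k) 1 - Pi.single (cst B Δ) 1) ∈ N)
    (hC : tens B (faceVec B (prof B Q i 0) ((0 : ZMod 2), i) ((1 : ZMod 2), i)) (Pi.single (cst B 0) 1) ∈ N)
    (hE : ∀ c : ZMod 4, (c = 0 ∨ c = 1) → tens B (faceVec B (prof B Q i 0) ((0 : ZMod 2), i) ((0 : ZMod 2), j)) (Pi.single (cst B c) 1) ∈ N) :
    hodge₂ B ≤ N := by
  have h3 : 3 ≤ Fintype.card B := by omega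
  obtain ⟨hF1, hF2, hF3⟩ := closing_classes_upper B ha hn hQ hi hj hji i hsq hcov hM hC hE
  obtain ⟨hX0, hX1, hW0, hW1, hD0, hD1⟩ := closing_moves B hmot hP hF1 hF2 hF3
  intro v hv
  obtain ⟨r, hr, hsupp⟩ := exists_reduced₂ B hcov₂ v
  have hrH : r ∈ hodge₂ B := by
    have e : r = v - (v - r) := by abel
    rw [e]
    exact Submodule.sub_mem _ hv (hNH hr)
  have hrN : r ∈ N := residual₂_mem B h3 hNH hP hX0 hX1 hW0 hW1 hD0 hD1 hrH hsupp
  have e : v = (v - r) + r := by abel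
  rw [e]
  exact Submodule.add_mem _ hr hrN

/-! ## §4 A generating family of at most `β − 1` octic faces, any parity -/

/-- **`μ(ℤ/8 × B, (4,0)) ≤ β − 1` FOR EVERY FINITE GROUP `B` OF ORDER `≥ 3`**: there is a finite family `S` of octic rank-four faces (coset
faces and mixed faces) whose motions generate the octic Hodge lattice modulo the octic pairs, integrally, with `|S| + 1 ≤ β = #Orb₂ B` (the
upper-end-oriented covering family of part XVIII plus the nine closing faces, against the ten residual blocks). [folklore] -/
theorem exists_faces_generate₂_all (h3 : 3 ≤ Fintype.card B) :
    ∃ S : Finset (Ty₂ B → ℤ), (∀ f ∈ S, IsFace₂ B f) ∧ hodge₂ B ≤ pairs₂ B ⊔ spanMot B S ∧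
      S.card + 1 ≤ Fintype.card (Orb₂ B) := by
  classical
  obtain ⟨a, ha, hn⟩ : ∃ a : ℕ, 1 ≤ a ∧ (Fintype.card B = 2 * a + 1 ∨ Fintype.card B = 2 * a + 2) :=
    ⟨(Fintype.card B - 1) / 2, by omega, by omega⟩
  obtain ⟨Q, i, j, hQ, hi, hj, hji⟩ := exists_equator' B (a := a) (by omega)
  obtain ⟨S, hSface, hScard, hcov₂, hsl, hsq⟩ := exists_ucover_family B h3
  -- the nine closing faces
  let P0 : Ty B := prof B Q i 0
  let P1 : Ty B := prof B Q i 1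
  let mixed : ZMod 4 → ZMod 4 → (Ty₂ B → ℤ) := fun Δ k =>
    tens B (Pi.single P0 1 - Pi.single P1 1) (Pi.single (atom B Δ i k) 1 - Pi.single (cst B Δ) 1)
  let col : Ty₂ B → ℤ := tens B (faceVec B P0 ((0 : ZMod 2), i) ((1 : ZMod 2), i)) (Pi.single (cst B 0) 1)
  let eqf : ZMod 4 → (Ty₂ B → ℤ) := fun c => tens B (faceVec B P0 ((0 : ZMod 2), i) ((0 : ZMod 2), j)) (Pi.single (cst B c) 1)
  let L : List (Ty₂ B → ℤ) :=
    [mixed 0 1, mixed 0 (-1), mixed 1 1, mixed 1 (-1), mixed 2 1, mixed 2 (-1), col, eqf 0, eqf 1]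
  let C : Finset (Ty₂ B → ℤ) := L.toFinset
  have hCcard : C.card ≤ 9 := (List.toFinset_card_le L).trans (by simp [L])
  have hCface : ∀ f ∈ C, IsFace₂ B f := by
    intro f hf
    have hf' : f ∈ L := List.mem_toFinset.mp hf
    simp only [L, List.mem_cons, List.mem_nil_iff, or_false] at hf'
    have hm1 : (1 : ZMod 4) = 1 ∨ (1 : ZMod 4) = -1 := Or.inl rfl
    have hm2 : (-1 : ZMod 4) = 1 ∨ (-1 : ZMod 4) = -1 := Or.inr rfl
    rcases hf' with rfl | rfl | rfl | rfl | rfl | rfl | rfl | rfl | rfl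
    · exact isFace₂_closing_mixed B Q hi 0 i hm1
    · exact isFace₂_closing_mixed B Q hi 0 i hm2
    · exact isFace₂_closing_mixed B Q hi 1 i hm1
    · exact isFace₂_closing_mixed B Q hi 1 i hm2
    · exact isFace₂_closing_mixed B Q hi 2 i hm1
    · exact isFace₂_closing_mixed B Q hi 2 i hm2
    · exact isFace₂_closing_column B Q i _
    · exact isFace₂_closing_square B Q hji _
    · exact isFace₂_closing_square B Q hji _
  have hCmem : ∀ f ∈ L, f ∈ C := fun f hf => List.mem_toFinset.mpr hf
  set S' : Finset (Ty₂ B → ℤ) := S ∪ C with hS'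
  have hS'face : ∀ f ∈ S', IsFace₂ B f := by
    intro f hf
    rcases Finset.mem_union.mp hf with hf | hf
    · exact hSface f hf
    · exact hCface f hf
  set N : Submodule ℤ (Ty₂ B → ℤ) := pairs₂ B ⊔ spanMot B S' with hN
  have hNH : N ≤ hodge₂ B := sup_le (pairs₂_le_hodge₂ B) (spanMot_le_hodge₂ B fun f hf => mem_hodge₂_of_isFace₂ B (hS'face f hf))
  have hmot : ∀ v ∈ N, ∀ (e : Bool) (h : ZMod 4 × B), transl₂ B e h v ∈ N := fun v hv e h => transl₂_mem_sup B hv e h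
  have hP : pairs₂ B ≤ N := le_sup_left
  have hMS : spanMot B S ≤ N := (spanMot_mono B Finset.subset_union_left).trans le_sup_right
  have hCN : ∀ f ∈ L, f ∈ N := fun f hf =>
    le_sup_right (b := spanMot B S') (mem_spanMot_of_mem B (Finset.mem_union_right S (hCmem f hf)))
  have hcovN : ∀ y : Ty B, IsRes B y → (¬ ∃ (u : ZMod 4) (b : B), y = atom B u b 2) → UCovers B (N.comap (emb₀ B y)) :=
    fun y hy h2 => ucovers_mono B (Submodule.comap_mono hMS) (hsl y hy h2)
  have hgen : hodge₂ B ≤ N := by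
    refine hodge₂_le_upper B ha hn hQ hi hj hji hNH hmot hP (covers₂_mono B hMS hcov₂) hcovN
      (fun u b k u' b' k' hk hk' => hMS (hsq u b k u' b' k' hk hk')) ?_ ?_ ?_
    · intro Δ k hΔ hk
      rcases hΔ with rfl | rfl | rfl <;> rcases hk with rfl | rfl
      · exact hCN (mixed 0 1) (by simp [L])
      · exact hCN (mixed 0 (-1)) (by simp [L])
      · exact hCN (mixed 1 1) (by simp [L])
      · exact hCN (mixed 1 (-1)) (by simp [L])
      · exact hCN (mixed 2 1) (by simp [L])
      · exact hCN (mixed 2 (-1)) (by simp [L])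
    · exact hCN col (by simp [L])
    · intro c hc
      rcases hc with rfl | rfl
      · exact hCN (eqf 0) (by simp [L])
      · exact hCN (eqf 1) (by simp [L])
  refine ⟨S', hS'face, hgen, ?_⟩
  have hsplit := card_blocks_split B
  have hten := ten_le_card_residual_blocks B h3
  have hS'card : S'.card ≤ S.card + C.card := Finset.card_union_le S C
  omega

end Summit.HodgeConjecture.CorCM.Census.OcticTwist
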